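/-
Copyright (c) 2026 the pub-hodgecm-mathlib formalisation cell (harness21).  Prover seat hodgecm-mathlib-K2E5-p16 (g5): Track B «K2-LIT»,
hLiu418 = stmt-HodgeConjecture-24832, ROAD Φ organ Φ6b-6 (β-shift of Shimura's `η` on `Herm₂(ℂ)`), file (0): the one new integrability
input — the cone integral with the coordinate weight `1∕x₂₂`; 2026-09-04.
-/
import Summits.HodgeConjecture.HodgeConjecture.Theorems.K2LiuHermTwoGammaSiegelGindikin     -- ★ p857689: Siegel–Gindikin on `Herm₂(ℂ)⁺`
import Mathlib.Analysis.SpecialFunctions.ImproperIntegrals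
import HarnessLib

/-!
# Crux `HLiu418`, ROAD Φ, organ Φ6b-6 — file (0): `∫_{x > 0} x₂₂⁻¹ e^{−tr(x y)} (det x)^{s−2} dx < ∞` for `1 < s`

Cell `hodgecm-mathlib`, crux item hLiu418 = `stmt-HodgeConjecture-24832`, route of record `HCCMUnconditional`; squad K2, LEAD F0P6-plan (g12),
co-dealer K2E5-plan (g5∕g6) (deal Φ6b-6 `K2LiuHermTwoEtaBetaShift`, 2026-09-04 07:07:41Z ∕ 07:13:02Z), prover K2E5-p16 (g5).  THEOREMS ONLY
(no `def`, no instance, no notation, no named-fact hypothesis, no `sorry`, default heartbeats); lane `--supports … --as helper` (count-neutral).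

WHY.  The β-shift of Shimura's `η(g, h; α, β)` [Shimura1982, §3] is obtained (file (3)) by ONE integration by parts in the coordinate
`a = x₁₁` of the chart `x = [[a, z],[z̄, b]]`; the price of a first-order, one-direction integration by parts is the coordinate weight
`1∕(x − h)₂₂` in the shifted integrand, singular on the ray `{(x − h)₂₂ = 0}` of the boundary of the cone.  This file pays that price once:

* `integrableOn_inv_snd_mul_siegelGindikin` — for `y = [[p, w],[w̄, q]] > 0` and a REAL `s > 1`, the function
  `x ↦ x₂₂⁻¹ · e^{−tr(x y)} (det x)^{s−2}` is integrable on the cone `{x > 0}` (Lebesgue measure of the chart `ℝ × ℂ × ℝ`).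

PROOF (the `t`-trick, print-free).  On the cone `b = x₂₂ > 0` and `b⁻¹ = ∫₀^∞ e^{−tb} dt`, while `e^{−tb} e^{−tr(x y)} = e^{−tr(x y_t)}` with
`y_t = y + t·E₂₂ = [[p, w],[w̄, q + t]] > 0`; by TONELLI (`lintegral_lintegral_swap`) the cone integral of the weighted integrand equals
`∫₀^∞ (∫_{x>0} e^{−tr(x y_t)} (det x)^{s−2} dx) dt = Γ₂(s) ∫₀^∞ det(y_t)^{−s} dt = π Γ(s) Γ(s−1) ∫₀^∞ (det y + p t)^{−s} dt < ∞`
(★ `integral_siegelGindikin_hermTwo` at `y_t`, read at a real exponent through `siegelGindikin_integrand_eq_ofReal`; the last integral converges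
because `s > 1`, ★ Mathlib `integrableOn_add_rpow_Ioi_of_lt`).
ALSO EXPORTED (used by files (2)–(4)): `norm_siegelGindikin_integrand` (the norm of the complex Siegel–Gindikin integrand at `s` is the real
integrand at `re s`), `integral_siegelGindikin_real`, `integrableOn_siegelGindikin_real`.
HONEST LABEL.  Count-neutral helper of the K2_Liu road; it pays no socket by itself: `HC_CM` is proved only modulo the 7 printed citations
(2 remaining named inputs: hLiu418 = `stmt-HodgeConjecture-24832`, h413 = `stmt-HodgeConjecture-24833`) until rung 0 closes.
-/

set_option autoImplicit false
-- the mandated namespace repeats the single-problem summit's segment (`HodgeConjecture.HodgeConjecture`)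
set_option linter.dupNamespace false

noncomputable section

open Complex MeasureTheory Set
open scoped ComplexOrder ComplexConjugate ENNReal

namespace Summit.HodgeConjecture.HodgeConjecture.Cruxes.HLiu418.K2LiuHermTwoConeInvEntryIntegrable

open Summit.HodgeConjecture.HodgeConjecture.Cruxes.HLiu418.K2LiuHermTwoGammaDefs
open Summit.HodgeConjecture.HodgeConjecture.Cruxes.HLiu418.K2LiuHermTwoGammaSiegelGindikin

/-! ## The Siegel–Gindikin integrand at a real exponent -/

/-- On the cone, the complex Siegel–Gindikin integrand at a REAL exponent `s` is the real number
`e^{−(ap + bq + 2 Re(z w̄))} (ab − |z|²)^{s−2}` (cast to `ℂ`). -/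
theorem siegelGindikin_integrand_eq_ofReal (d : ℝ × ℂ × ℝ) (s : ℝ) {c : ℝ × ℂ × ℝ} (hc : 0 < c.1 ∧ normSq c.2.1 < c.1 * c.2.2) :
    cexp (-(hermTwo c * hermTwo d).trace) * (hermTwo c).det ^ ((s : ℂ) - 2) =
      ((Real.exp (-(c.1 * d.1 + c.2.2 * d.2.2 + 2 * (c.2.1 * conj d.2.1).re)) * (c.1 * c.2.2 - normSq c.2.1) ^ (s - 2) : ℝ) : ℂ) := by
  have hdet : 0 < c.1 * c.2.2 - normSq c.2.1 := by linarith [hc.2]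
  rw [trace_hermTwo_mul_hermTwo, det_hermTwo, ← Complex.ofReal_neg, ← Complex.ofReal_exp,
    show ((s : ℂ) - 2) = ((s - 2 : ℝ) : ℂ) by push_cast; ring, ← Complex.ofReal_cpow hdet.le, ← Complex.ofReal_mul]

/-- On the cone, the NORM of the complex Siegel–Gindikin integrand at `s` is the real integrand at `re s`:
`‖e^{−tr(x y)} (det x)^{s−2}‖ = e^{−(ap + bq + 2 Re(z w̄))} (ab − |z|²)^{re s − 2}`. -/
theorem norm_siegelGindikin_integrand (d : ℝ × ℂ × ℝ) (s : ℂ) {c : ℝ × ℂ × ℝ} (hc : 0 < c.1 ∧ normSq c.2.1 < c.1 * c.2.2) :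
    ‖cexp (-(hermTwo c * hermTwo d).trace) * (hermTwo c).det ^ (s - 2)‖ =
      Real.exp (-(c.1 * d.1 + c.2.2 * d.2.2 + 2 * (c.2.1 * conj d.2.1).re)) * (c.1 * c.2.2 - normSq c.2.1) ^ (s.re - 2) := by
  have hdet : 0 < c.1 * c.2.2 - normSq c.2.1 := by linarith [hc.2]
  rw [norm_mul, Complex.norm_exp, trace_hermTwo_mul_hermTwo, det_hermTwo, norm_cpow_eq_rpow_re_of_pos hdet]
  simp

/-- The real Siegel–Gindikin integrand is nonnegative on the cone. -/
theorem siegelGindikin_real_nonneg (d : ℝ × ℂ × ℝ) (s : ℝ) {c : ℝ × ℂ × ℝ} (hc : 0 < c.1 ∧ normSq c.2.1 < c.1 * c.2.2) :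
    0 ≤ Real.exp (-(c.1 * d.1 + c.2.2 * d.2.2 + 2 * (c.2.1 * conj d.2.1).re)) * (c.1 * c.2.2 - normSq c.2.1) ^ (s - 2) := by
  have hdet : 0 < c.1 * c.2.2 - normSq c.2.1 := by linarith [hc.2]
  exact mul_nonneg (Real.exp_pos _).le (Real.rpow_nonneg hdet.le _)

/-- The real Siegel–Gindikin integrand is measurable. -/
theorem measurable_siegelGindikin_real (d : ℝ × ℂ × ℝ) (s : ℝ) :
    Measurable fun c : ℝ × ℂ × ℝ =>
      Real.exp (-(c.1 * d.1 + c.2.2 * d.2.2 + 2 * (c.2.1 * conj d.2.1).re)) * (c.1 * c.2.2 - normSq c.2.1) ^ (s - 2) := by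
  refine Measurable.mul (Real.measurable_exp.comp ?_) (Measurable.pow_const ?_ _)
  · refine Measurable.neg (Measurable.add (by fun_prop) (Measurable.const_mul (Complex.measurable_re.comp ?_) 2))
    exact (measurable_fst.comp measurable_snd).mul_const _
  · exact (measurable_fst.mul (measurable_snd.comp measurable_snd)).sub (Complex.continuous_normSq.measurable.comp (measurable_fst.comp measurable_snd))

/-- **SIEGEL–GINDIKIN AT A REAL EXPONENT** (value): for `y = [[p, w],[w̄, q]] > 0` and real `s > 1`,
`∫_{x > 0} e^{−tr(x y)} (det x)^{s−2} dx = π Γ(s) Γ(s−1) (pq − |w|²)^{−s}` as an identity of REAL numbers. -/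
theorem integral_siegelGindikin_real (d : ℝ × ℂ × ℝ) (hd : 0 < d.1 ∧ normSq d.2.1 < d.1 * d.2.2) {s : ℝ} (hs : 1 < s) :
    ∫ c in {c : ℝ × ℂ × ℝ | (hermTwo c).PosDef},
        Real.exp (-(c.1 * d.1 + c.2.2 * d.2.2 + 2 * (c.2.1 * conj d.2.1).re)) * (c.1 * c.2.2 - normSq c.2.1) ^ (s - 2) =
      Real.pi * Real.Gamma s * Real.Gamma (s - 1) * (d.1 * d.2.2 - normSq d.2.1) ^ (-s) := by
  have hD : 0 < d.1 * d.2.2 - normSq d.2.1 := by linarith [hd.2]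
  have h := integral_siegelGindikin_hermTwo d hd (s := (s : ℂ)) (by simpa using hs)
  have hcongr : ∫ c in {c : ℝ × ℂ × ℝ | (hermTwo c).PosDef}, cexp (-(hermTwo c * hermTwo d).trace) * (hermTwo c).det ^ ((s : ℂ) - 2) =
      ∫ c in {c : ℝ × ℂ × ℝ | (hermTwo c).PosDef},
        ((Real.exp (-(c.1 * d.1 + c.2.2 * d.2.2 + 2 * (c.2.1 * conj d.2.1).re)) * (c.1 * c.2.2 - normSq c.2.1) ^ (s - 2) : ℝ) : ℂ) :=
    setIntegral_congr_fun measurableSet_posDef_hermTwo fun c hc =>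
      siegelGindikin_integrand_eq_ofReal d s ((posDef_hermTwo_iff c).mp hc)
  rw [hcongr, integral_complex_ofReal, hermTwoGamma_def, show ((s : ℂ) - 1) = ((s - 1 : ℝ) : ℂ) by push_cast; ring, Complex.Gamma_ofReal,
    Complex.Gamma_ofReal, show (-(s : ℂ)) = ((-s : ℝ) : ℂ) by push_cast; ring, ← Complex.ofReal_cpow hD.le] at h
  exact_mod_cast h

/-- **SIEGEL–GINDIKIN AT A REAL EXPONENT** (absolute convergence): the real integrand is integrable on the cone (`y > 0`, `s > 1`). -/
theorem integrableOn_siegelGindikin_real (d : ℝ × ℂ × ℝ) (hd : 0 < d.1 ∧ normSq d.2.1 < d.1 * d.2.2) {s : ℝ} (hs : 1 < s) :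
    IntegrableOn (fun c : ℝ × ℂ × ℝ =>
      Real.exp (-(c.1 * d.1 + c.2.2 * d.2.2 + 2 * (c.2.1 * conj d.2.1).re)) * (c.1 * c.2.2 - normSq c.2.1) ^ (s - 2))
      {c : ℝ × ℂ × ℝ | (hermTwo c).PosDef} := by
  have h := (integrableOn_siegelGindikin_hermTwo d hd (s := (s : ℂ)) (by simpa using hs)).norm
  refine IntegrableOn.congr_fun h (fun c hc => ?_) measurableSet_posDef_hermTwo
  rw [norm_siegelGindikin_integrand d (s : ℂ) ((posDef_hermTwo_iff c).mp hc), Complex.ofReal_re]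

/-! ## The `t`-trick: `b⁻¹ = ∫₀^∞ e^{−tb} dt` and `e^{−tb} e^{−tr(x y)} = e^{−tr(x y_t)}` -/

/-- For `b > 0`: `∫₀^∞ e^{−tb} dt = b⁻¹`. -/
theorem integral_exp_neg_mul_Ioi {b : ℝ} (hb : 0 < b) : ∫ t in Ioi (0 : ℝ), Real.exp (-(t * b)) = b⁻¹ := by
  have h := integral_exp_mul_Ioi (a := -b) (by linarith) 0
  simp only [mul_zero, Real.exp_zero] at h
  have hf : (fun t : ℝ => Real.exp (-(t * b))) = fun t => Real.exp (-b * t) := by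
    funext t
    ring_nf
  rw [hf, h]
  field_simp

/-- For `b > 0`, `t ↦ e^{−tb}` is integrable on `(0, ∞)`. -/
theorem integrableOn_exp_neg_mul_Ioi {b : ℝ} (hb : 0 < b) : IntegrableOn (fun t : ℝ => Real.exp (-(t * b))) (Ioi 0) := by
  have hf : (fun t : ℝ => Real.exp (-(t * b))) = fun t => Real.exp (-b * t) := by
    funext t
    ring_nf
  rw [hf]
  exact integrableOn_exp_mul_Ioi (by linarith) 0

/-- The perturbed parameter `y_t = [[p, w],[w̄, q + t]]` stays positive definite for `t > 0` (indeed `t ≥ 0`). -/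
theorem posDef_chart_add {d : ℝ × ℂ × ℝ} (hd : 0 < d.1 ∧ normSq d.2.1 < d.1 * d.2.2) {t : ℝ} (ht : 0 ≤ t) :
    0 < (d.1, d.2.1, d.2.2 + t).1 ∧ normSq (d.1, d.2.1, d.2.2 + t).2.1 < (d.1, d.2.1, d.2.2 + t).1 * (d.1, d.2.1, d.2.2 + t).2.2 := by
  refine ⟨hd.1, ?_⟩
  simp only
  nlinarith [hd.1, hd.2]

/-- The real Siegel–Gindikin integrand at `y_t` is `e^{−tb}` times the one at `y`. -/
theorem siegelGindikin_real_chart_add (d : ℝ × ℂ × ℝ) (s t : ℝ) (c : ℝ × ℂ × ℝ) :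
    Real.exp (-(c.1 * (d.1, d.2.1, d.2.2 + t).1 + c.2.2 * (d.1, d.2.1, d.2.2 + t).2.2 +
        2 * (c.2.1 * conj (d.1, d.2.1, d.2.2 + t).2.1).re)) * (c.1 * c.2.2 - normSq c.2.1) ^ (s - 2) =
      Real.exp (-(t * c.2.2)) *
        (Real.exp (-(c.1 * d.1 + c.2.2 * d.2.2 + 2 * (c.2.1 * conj d.2.1).re)) * (c.1 * c.2.2 - normSq c.2.1) ^ (s - 2)) := by
  simp only
  rw [← mul_assoc, ← Real.exp_add]
  congr 2
  ring

/-! ## The head -/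

/-- The last `t`-integral converges: for `D > 0`, `p > 0`, `s > 1`, `t ↦ (D + p t)^{−s}` is integrable on `(0, ∞)`. -/
theorem integrableOn_add_mul_rpow_neg_Ioi {D p s : ℝ} (hD : 0 < D) (hp : 0 < p) (hs : 1 < s) :
    IntegrableOn (fun t : ℝ => (D + p * t) ^ (-s)) (Ioi 0) := by
  have h := (integrableOn_add_rpow_Ioi_of_lt (a := -s) (m := D / p) (c := 0) (by linarith)
    (by rw [neg_lt, neg_zero]; positivity)).const_mul (p ^ (-s))
  refine IntegrableOn.congr_fun h (fun t ht => ?_) measurableSet_Ioi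
  have ht' : 0 < t := ht
  have hsplit : D + p * t = p * (t + D / p) := by
    field_simp
    ring
  rw [hsplit, Real.mul_rpow hp.le (by positivity)]

/-- **THE WEIGHTED CONE INTEGRAL CONVERGES** (organ Φ6b-6, file (0)).  For `y = [[p, w],[w̄, q]] > 0` (chart `d = (p, w, q)`) and a real
exponent `s > 1`, the function `x ↦ x₂₂⁻¹ · e^{−tr(x y)} (det x)^{s−2}` — the real Siegel–Gindikin integrand with the coordinate weight `1∕b` —
is integrable on the cone `{x > 0}` of the chart `x = hermTwo (a, z, b)`.  (Value: `π Γ(s) Γ(s−1) ∫₀^∞ (det y + p t)^{−s} dt`.) -/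
theorem integrableOn_inv_snd_mul_siegelGindikin (d : ℝ × ℂ × ℝ) (hd : 0 < d.1 ∧ normSq d.2.1 < d.1 * d.2.2) {s : ℝ} (hs : 1 < s) :
    IntegrableOn (fun c : ℝ × ℂ × ℝ => c.2.2⁻¹ *
      (Real.exp (-(c.1 * d.1 + c.2.2 * d.2.2 + 2 * (c.2.1 * conj d.2.1).re)) * (c.1 * c.2.2 - normSq c.2.1) ^ (s - 2)))
      {c : ℝ × ℂ × ℝ | (hermTwo c).PosDef} := by
  have hD : 0 < d.1 * d.2.2 - normSq d.2.1 := by linarith [hd.2]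
  -- names
  set F : ℝ × ℂ × ℝ → ℝ := fun c =>
    Real.exp (-(c.1 * d.1 + c.2.2 * d.2.2 + 2 * (c.2.1 * conj d.2.1).re)) * (c.1 * c.2.2 - normSq c.2.1) ^ (s - 2) with hFdef
  have hFm : Measurable F := measurable_siegelGindikin_real d s
  set S : Set (ℝ × ℂ × ℝ) := {c : ℝ × ℂ × ℝ | (hermTwo c).PosDef} with hSdef
  have hSm : MeasurableSet S := measurableSet_posDef_hermTwo
  -- measurability of the weighted integrand
  have hmeas : Measurable fun c : ℝ × ℂ × ℝ => c.2.2⁻¹ * F c := (measurable_snd.comp measurable_snd).inv.mul hFm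
  refine ⟨hmeas.aestronglyMeasurable, ?_⟩
  -- nonnegativity on the cone
  have hnn : 0 ≤ᵐ[volume.restrict S] fun c : ℝ × ℂ × ℝ => c.2.2⁻¹ * F c := by
    refine (ae_restrict_iff' hSm).mpr (Filter.Eventually.of_forall fun c hc => ?_)
    have hc' := (posDef_hermTwo_iff c).mp hc
    have hb : 0 < c.2.2 := (mul_pos_iff_of_pos_left hc'.1).mp (lt_of_le_of_lt (normSq_nonneg _) hc'.2)
    exact mul_nonneg (inv_nonneg.mpr hb.le) (siegelGindikin_real_nonneg d s hc')
  rw [hasFiniteIntegral_iff_ofReal hnn]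
  -- (1) pointwise on the cone: `ofReal (b⁻¹ F) = ∫⁻_{t>0} ofReal (e^{−tb} F)`
  have h1 : ∫⁻ c in S, ENNReal.ofReal (c.2.2⁻¹ * F c) =
      ∫⁻ c in S, ∫⁻ t in Ioi (0 : ℝ), ENNReal.ofReal (Real.exp (-(t * c.2.2)) * F c) := by
    refine setLIntegral_congr_fun hSm fun c hc => ?_
    have hc' := (posDef_hermTwo_iff c).mp hc
    have hb : 0 < c.2.2 := (mul_pos_iff_of_pos_left hc'.1).mp (lt_of_le_of_lt (normSq_nonneg _) hc'.2)
    have hF0 : 0 ≤ F c := siegelGindikin_real_nonneg d s hc'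
    rw [← integral_exp_neg_mul_Ioi hb, ← integral_mul_const]
    refine ofReal_integral_eq_lintegral_ofReal ((integrableOn_exp_neg_mul_Ioi hb).mul_const _) ?_
    exact Filter.Eventually.of_forall fun t => mul_nonneg (Real.exp_pos _).le hF0
  -- (2) Tonelli
  have h2 : ∫⁻ c in S, ∫⁻ t in Ioi (0 : ℝ), ENNReal.ofReal (Real.exp (-(t * c.2.2)) * F c) =
      ∫⁻ t in Ioi (0 : ℝ), ∫⁻ c in S, ENNReal.ofReal (Real.exp (-(t * c.2.2)) * F c) := by
    refine lintegral_lintegral_swap (Measurable.aemeasurable ?_)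
    refine ENNReal.measurable_ofReal.comp ?_
    exact (Real.measurable_exp.comp ((measurable_snd.mul (measurable_snd.comp (measurable_snd.comp measurable_fst))).neg)).mul
      (hFm.comp measurable_fst)
  -- (3) the inner cone integral at fixed `t > 0` is Siegel–Gindikin at `y_t`
  have h3 : ∀ t ∈ Ioi (0 : ℝ), ∫⁻ c in S, ENNReal.ofReal (Real.exp (-(t * c.2.2)) * F c) =
      ENNReal.ofReal (Real.pi * Real.Gamma s * Real.Gamma (s - 1) * (d.1 * d.2.2 - normSq d.2.1 + d.1 * t) ^ (-s)) := by
    intro t ht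
    have hdt := posDef_chart_add hd (le_of_lt ht)
    have hI := integral_siegelGindikin_real (d.1, d.2.1, d.2.2 + t) hdt hs
    have hInt := integrableOn_siegelGindikin_real (d.1, d.2.1, d.2.2 + t) hdt hs
    simp_rw [siegelGindikin_real_chart_add d s t] at hI hInt
    have hval : (d.1, d.2.1, d.2.2 + t).1 * (d.1, d.2.1, d.2.2 + t).2.2 - normSq (d.1, d.2.1, d.2.2 + t).2.1 =
        d.1 * d.2.2 - normSq d.2.1 + d.1 * t := by
      simp only
      ring
    rw [hval] at hI
    rw [← hI]
    symm
    refine ofReal_integral_eq_lintegral_ofReal hInt ?_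
    refine (ae_restrict_iff' hSm).mpr (Filter.Eventually.of_forall fun c hc => ?_)
    exact mul_nonneg (Real.exp_pos _).le (siegelGindikin_real_nonneg d s ((posDef_hermTwo_iff c).mp hc))
  have h3' : ∫⁻ t in Ioi (0 : ℝ), ∫⁻ c in S, ENNReal.ofReal (Real.exp (-(t * c.2.2)) * F c) =
      ∫⁻ t in Ioi (0 : ℝ), ENNReal.ofReal (Real.pi * Real.Gamma s * Real.Gamma (s - 1) * (d.1 * d.2.2 - normSq d.2.1 + d.1 * t) ^ (-s)) :=
    setLIntegral_congr_fun measurableSet_Ioi h3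
  -- (4) the `t`-integral is finite
  have hC : 0 ≤ Real.pi * Real.Gamma s * Real.Gamma (s - 1) :=
    mul_nonneg (mul_nonneg Real.pi_pos.le (Real.Gamma_pos_of_pos (by linarith)).le) (Real.Gamma_pos_of_pos (by linarith)).le
  have hInt4 : IntegrableOn (fun t : ℝ => Real.pi * Real.Gamma s * Real.Gamma (s - 1) * (d.1 * d.2.2 - normSq d.2.1 + d.1 * t) ^ (-s))
      (Ioi 0) := (integrableOn_add_mul_rpow_neg_Ioi hD hd.1 hs).const_mul _
  have h4 : ∫⁻ t in Ioi (0 : ℝ), ENNReal.ofReal (Real.pi * Real.Gamma s * Real.Gamma (s - 1) * (d.1 * d.2.2 - normSq d.2.1 + d.1 * t) ^ (-s)) =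
      ENNReal.ofReal (∫ t in Ioi (0 : ℝ), Real.pi * Real.Gamma s * Real.Gamma (s - 1) * (d.1 * d.2.2 - normSq d.2.1 + d.1 * t) ^ (-s)) := by
    symm
    refine ofReal_integral_eq_lintegral_ofReal hInt4 ?_
    refine (ae_restrict_iff' measurableSet_Ioi).mpr (Filter.Eventually.of_forall fun t ht => ?_)
    have ht' : 0 < t := ht
    exact mul_nonneg hC (Real.rpow_nonneg (add_nonneg hD.le (mul_nonneg hd.1.le ht'.le)) _)
  rw [h1, h2, h3', h4]
  exact ENNReal.ofReal_lt_top

end Summit.HodgeConjecture.HodgeConjecture.Cruxes.HLiu418.K2LiuHermTwoConeInvEntryIntegrable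

end
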